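import Summits.QuantumFields.YangMills.Theorems.BalabanUVNodesN12Prop1DirectOfChartHalfOfClassRowL1NearExplicit
import Summits.QuantumFields.YangMills.Theorems.BalabanUVNodesN12DirectSurjHsurjProxies
import Summits.QuantumFields.YangMills.Theorems.BalabanUVNodesN12SiteProxiesOfClass
import Summits.QuantumFields.YangMills.Theorems.BalabanUVNodesN12ChartCurvatureL1OfClass
import Summits.QuantumFields.YangMills.Theorems.BalabanUVNodesN12DirectChartPackageOfClassRowL1Family

/-!
# BalabanUVNodes ∕ N12 — (D1)⁶ `(iii)_direct`, EXPLICIT-THRESHOLD FRAME, NO SMALL-BELOW LETTER, (μ) ROW IN PER-ROW ℓ¹ CURRENCY, BOOKKEEPING ROWS `hcA` ∕ `hcJ'` IN THE NEAR CURRENCY: (P2c)⁗ WITH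
# THE (P4)′ SOCKET fed by dag-n12-w6 g7's PROXIES edition (per-row ℓ¹ preimage letter at `B₁`) and the (P5) row fed by ρ7 with the local count `Σ_{j≤k}(2d)^j` — (D1)⁵ re-keyed (census U3)

Cell `pub-ymgap` (HUMAN RULINGS D-0062 ∕ D-0149), seat `pub-ymgap-dag-n12-d` g22 (R134 N12 [B15] s2; the lane's SPLIT (A′) of the U3 (γ) cascade, INBOX 2026-08-29T03:18:18Z; this file is
(T2)).  Count-neutral helper of K1⁹ `stmt-QuantumFields-27364` (`--kind proof --supports … --as helper`).  THEOREMS ONLY (0 `def`, 0 `instance`, 0 `sorry`); composition BY NAME of this seat's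
(P2c)⁗ `N12Prop1DirectOfChartHalfOfClassRowL1NearExplicit.…`, dag-n12-w6 g7's `N12DirectSurjHsurjProxies` letter shape with ρ5b `towerProxies_Bj_of_mem_class` ∕ `siteProxies_Bj_of_mem_class`
∕ `differentiableAt_msChart_of_towerProxies`, ρ7 `N12ChartCurvatureL1OfClass.sum_norm_fderiv_fderiv_msChart_apply_le_of_class` ∕ `hovl_geometric`, `B15Prop1NumericsThresholds.plaqSmallOn_of_le`
— exactly the names (D1)⁵ (p687816) composes but for the (P2c) head; (D1)⁵'s §2 producer `exists_rowPreimageProxiesLetter_family` (and the per-height junction `…RowL1UniformB` p691324) is NOT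
re-declared: the displayed letter `hHrow` is byte-identical, so they serve this edition as they stand.

WHY (census axis U3 of dag-n12-c's `N12-UNIFORMITY-SPEC.md` §4 v2; this seat's trigger t111).  In the v10 road of record the two bookkeeping rows of [IV] Proposition 1's endpoint were displayed
against the TORUS plaquette count: the near-value constant `hcA : ½(B₃(c_E+1)η₁²)²·|Plaq(T_η)| ≤ cA` ((Vn), `B15Prop1Thm1GeneralFormShapes.nearValue_letter_of_thm1Guarded` bounding
`#S ≤ |Plaq|`) and the gradient constant `hcJ' : 2cA·eR∕R + 4·(|Plaq|·(1+8𝓐₀⁴))∕(R·eR) ≤ cJ` ((L3) read through the TOTAL value's holomorphic extension, `B15Prop1GradientFromNearValue` §2 on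
`B15Prop1JointHolomorphyFromBackground.norm_actionSum_le`).  Print compares actions on the component only ([Balaban1989LargeFieldI] (1.77) *«defined in each component of Z separately»*;
[Balaban1989LargeFieldII] (1.2)–(1.6) p. 357).  dag-n12-c g23 typed the repair on the Literature side: `B15Prop1GradientFromNearValue` §4 (v1.1, p692504: the gradient letter through the near
value's OWN extension, letter (J1ˢ) `hGjS`, `hcJ' : 2cA·eR∕R + 2𝓐S∕(R·eR) ≤ cJ`), `B15Prop1NearValueOfMinimiserFamily` ((J1ˢ) ⇐ (J0′) with `𝓐S = #S·(1+8𝓐₀⁴)`), `B15Prop1CoerciveEditionNearExt`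
(the record-level layers; `nearValue_letter_of_thm1Guarded_nearCount` for `hcA`) and `B15Prop1WindowDirectPackageNearExt` (the window-direct head `…_ofWindowLetters_ofCoercive_nearExt`), with
`#S_i := Nat.card {q : Plaq(T_η) ∕∕ q ∈ plaqsOf Ω₁(Z_i)}` the NEAR plaquette count of the instance.  THIS FILE carries the change to the Summits side: the two rows become
`hcA : ∀ i, ½(B₃(c_E+1)η₁²)²·#S_i ≤ cA` and `hcJ' : ∀ i, 2cA·eR i∕R i + 2·(#S_i·(1+8(𝓐₀ i)⁴))∕(R i·eR i) ≤ cJ`; after it every count DISPLAYED on N12's direct road is a large-field-REGION count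
(`#S_i`, `√#bonds(Ω₁(Z_i))` in the (K) row, the window's site count) — the torus count survives only inside the analytic-extension clause's radius `…∕(48(4·|Plaq|(1+8𝓐₀⁴)∕R + 1))` of the
CONCLUSION (joint implicit-function step; dag-n12-c's HONEST SCOPE), not in any hypothesis row or in `Θ`.

WHAT.  (D1)⁵'s §1 statement VERBATIM except the two rows `hcA` (now `∀ i`, near count) and `hcJ'` (near count, factor `2`); proof VERBATIM (one application of (P2c)⁗ at
`M₂ := (Σ_{j≤k i}(2d)^j)·M₂ i`).  Downstream: (E1)⁷, knit «v11».

HONEST FRAMING ∕ LOCATED.  ∃∕∀ bookkeeping by name; display-level change only (which count the two bookkeeping rows read); nothing of Bałaban's asserted; count-neutral;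
N12 NOT discharged; K1⁹ NOT closed; counts unmoved; one finite 𝕋⁴ programme at fixed `ε = L^{-K}` — R4 closes only the conditional rung `BalabanLadder.UV`; no summit statement is
proved here and NOT the Yang–Mills mass gap (Clay); nothing continuum ∕ ℝ⁴ ∕ OS.

References: [Balaban1989LargeFieldI] CMP 122 (1989) 175–202, (1.74) p.192, (1.77) p.194, Prop. 1 (1.77)–(1.78) p.194, (1.79) p.195; [Balaban1989LargeFieldII] CMP 122 (1989) 355–392,
(1.2)–(1.6) p.357, (1.7)–(1.9) p.358, (1.11)–(1.13) pp.358–359; [Balaban1985Variational] CMP 102 (1985) 277–309, (2)–(4) p.278, Thm 1 (8) p.279, (44)–(48) p.285, (81)–(83) p.290;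
[Balaban1985Averaging] CMP 98 (1985) 17–51, (5) p.18, (19) p.21, Prop. 2 (52)–(53) p.26; [Balaban1988Convergent] CMP 119 (1988) 243–285, (2.2) p.255, (2.10)–(2.14) pp.256–257, (2.16) p.257.
-/

noncomputable section

open Set Finset Metric Filter
open scoped BigOperators Matrix RealInnerProductSpace Real InnerProductSpace Topology Matrix.Norms.L2Operator

namespace Summit.QuantumFields.YangMills.BalabanUVNodes.N12Prop1DirectOfClassOnlyRowL1Near

open Literature.MathematicalPhysics.QuantumFieldTheory.Balaban1983to89
open T4Continuum B15DeterminingSets GaugeField B16Sect1Backgrounds B15Prop1Carrier B8Eq17ClassAkV1 BlockAveraging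
open B15Prop1SliceTaylorCalculus
open B15Prop1ChartCalculusSU2 (E3)
open T4CubeChartGnomonic (SU2)
open B15Prop1ChartSU2 (su2Chart)
open B15Prop1SliceCoordinates (GaugeSlice ιA freeBonds)
open B15Prop1AnalyticExtClause (cplxVec anExt)
open T4AdjointCovarianceUnitary (lieSU)
open T4AxialGaugeSmallField (castSite boxPlaqs boxBonds)
open B6BondElimination (unitVec)
open B6TreeGaugePoincare (curl)
open B16Eq18Proof (box mem_box)
open B15Extension193 (extend)
open B15ShellGauge193 (shellGauge)
open B14.Eq213MaximalDomains (side)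
open B14.Eq213DetSet B14.Eq216Concrete B15Sect1Instances B15Eq177GaugeInvariance B15Eq177ValueInvariance B15Eq177ValueInvarianceCoDiv B16Sect1Wilson
open B14.Eq22Determines (blockIter IsBlockUnion)
open Literature.MathematicalPhysics.QuantumFieldTheory.BalabanImbrieJaffe1984to88.BIJ85Eq453GaugeField
open Node00 (expChart msChart constrCard)
open B15Eq112TorusCover (lift)
open B5Eq118OneStroke (iterBlockOf)
open Summit.QuantumFields.YangMills.BalabanUVNodes.N12Prop1DirectOfChartHalfOfClassRowL1NearExplicit (exists_domain_prop1Printed_lfVarOn_std_su2_box_intrinsic_analytic_atZSeqCoPRecord_ofThm1TorusClass_ofMinimiserFamily_ofWindowGaugeLetter_ofChartHalfOfClassRowL1Near_explicit)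
open Summit.QuantumFields.YangMills.BalabanUVNodes.N12TowerProxiesOfClass (towerProxies_Bj_of_mem_class)
open Summit.QuantumFields.YangMills.BalabanUVNodes.N12DirectSurjHsurjProxiesPrelim (differentiableAt_msChart_of_towerProxies)
open Summit.QuantumFields.YangMills.BalabanUVNodes.N12SiteProxiesOfClass (siteProxies_Bj_of_mem_class)
open Summit.QuantumFields.YangMills.BalabanUVNodes.N12ChartCurvatureL1OfClass (sum_norm_fderiv_fderiv_msChart_apply_le_of_class hovl_geometric)
open Node00 (avOfRecord regMSCoPOfRecord coeField constrEnum)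
open B15Prop1NumericsThresholds (plaqSmallOn_of_le)

variable {F : T4Family}
/-- ★★★ **(D1)⁶ `(iii)_direct` — NO SMALL-BELOW LETTER, (μ) ROW IN PER-ROW ℓ¹ CURRENCY, BOOKKEEPING ROWS IN THE NEAR CURRENCY (census U3): (P2c)⁗ with the (P4)′ socket fed by dag-n12-w6 g7's
PROXIES edition in ρ6b's currency and the (P5) row fed by ρ7's ℓ¹-curvature bound with the local count `Σ_{j≤k}(2d)^j`.**  (D1)⁵'s (p687816) statement VERBATIM with the two bookkeeping rows
re-typed against the near plaquette count `#S_i := Nat.card {q : Plaq(T_η) ∕∕ q ∈ plaqsOf Ω₁(Z_i)}`: `hcA : ∀ i, ½(B₃(c_E+1)η₁²)²·#S_i ≤ cA`, `hcJ' : ∀ i, 2cA·eR i∕R i + 2·(#S_i·(1+8(𝓐₀ i)⁴))∕(R i·eR i) ≤ cJ`;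
binders `εH B₁` + the letter `hHrow`, `ρ6 M₂` + letters `hsbU hcurv` + floor `hερ6`, `hPbox` in the frame at `δ i`, threshold `min (Θ i) (εH i)` ((μ)-term `2(d−1)·B₁ i·((Σ_{j≤k i}(2d)^j)·M₂ i)`),
the clause's radius (total bound) UNCHANGED.  Proof: (D1)⁵'s verbatim, ONE application of (P2c)⁗ at `M₂ := (Σ_{j≤k i}(2d)^j)·M₂ i`.  The displayed `hHrow` family is inhabited exactly as for (D1)⁵
(its §2 `N12Prop1DirectOfClassOnlyRowL1.exists_rowPreimageProxiesLetter_family` and the per-height junction `N12Prop1DirectOfClassOnlyRowL1UniformB` serve this edition verbatim — the letter text is unchanged).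
[cite: Balaban1989LargeFieldI, (1.74) p.192, (1.77) and Prop. 1 (1.77)–(1.78) p.194, (1.79) p.195; Balaban1989LargeFieldII, (1.2)–(1.6) p.357, (1.7)–(1.9) p.358, (1.11)–(1.13) pp.358–359; Balaban1985Variational, (2)–(4) p.278, Thm 1 (8) p.279, (44)–(48) p.285, (81)–(83) p.290; Balaban1985Averaging, (5) p.18, (19) p.21; Balaban1988Convergent, (2.2) p.255, (2.10)–(2.14) pp.256–257] -/
theorem exists_domain_prop1Printed_lfVarOn_std_su2_box_intrinsic_analytic_atZSeqCoPRecord_ofThm1TorusClass_ofMinimiserFamily_ofWindowGaugeLetter_ofClassOnlyRowL1Near_explicit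
    (ν : Node00.Stage7Numerics) (Kt : ℕ) (hd3 : 3 ≤ (F.P Kt).d) (h0 : 0 < (F.P Kt).d) {ι : Type}
    (Z Λ : ι → Set (Site (F.P Kt) 0)) (k : ι → ℕ) (M : ι → ℝ) (hk0 : ∀ i, 0 < k i) (hk1 : ∀ i, k i + 1 ≤ (F.P Kt).m + (F.P Kt).K)
    (eR : ι → ℝ) (heR : ∀ i, 0 < eR i)
    (T : ∀ i, Finset (PBond (F.P Kt) (k i)))
    (lo hi : ι → Fin (F.P Kt).d → ℤ) (n : ι → ℕ) (hn : ∀ i κ, hi i κ ≤ lo i κ + n i) (hN : ∀ i, n i + 2 < (F.P Kt).sitesPerDir (k i))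
    (hbox : ∀ i, pts (k i) (Λ i) = (castSite '' Set.Icc (lo i) (hi i) : Set (Site (F.P Kt) (k i))))
    (hZ : ∀ i, (boxPlaqs (lo i - 1) (hi i + 1) : Set (Plaq (F.P Kt) (k i))) ⊆ plaqsInside (pts (k i) (Z i)))
    (hTG0 : ∀ i, T i = (box (fun κ => (hi i κ - lo i κ + 1).toNat) (lo i)).image fun x =>
      (⟨castSite (x - unitVec ⟨0, h0⟩), ⟨0, h0⟩⟩ : PBond (F.P Kt) (k i)))
    (hN5 : ∀ i κ, ((hi i κ - lo i κ + 1).toNat : ℤ) + 5 < (F.P Kt).sitesPerDir (k i))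
    (K : ι → ℕ) (hK1 : ∀ i, 1 ≤ K i) (hKn : ∀ i κ, (hi i κ - lo i κ + 1).toNat ≤ K i)
    (ext : ∀ i, GaugeField (F.P Kt) (k i) SU2 → GaugeField (F.P Kt) (k i) SU2)
    (hext : ∀ i Vk, ext i Vk = extend (pts (k i) (Λ i)) (shellGauge Vk (lo i) (hi i)) Vk)
    (hlohi : ∀ i, lo i ≤ hi i)
    -- the REGION parallelepipeds of the normalisation and the datum tolerances
    (LO HI : ι → Fin (F.P Kt).d → ℤ) (hLO : ∀ i, LO i ≤ lo i - 1) (hHI : ∀ i, hi i + 1 ≤ HI i) (n' : ι → ℕ) (hn' : ∀ i κ, HI i κ ≤ LO i κ + n' i)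
    (hn'N : ∀ i, n' i < (F.P Kt).sitesPerDir (k i)) (hR' : ∀ i, (boxPlaqs (LO i) (HI i) : Set (Plaq (F.P Kt) (k i))) ⊆ plaqsInside (pts (k i) (Z i)))
    (ρn : ι → ℝ)
    (hρn : ∀ i, (((F.P Kt).d : ℝ) * n' i + 1) * ((((F.P Kt).d - 1 : ℕ) : ℝ) * n' i * ((12 * (F.P Kt).d * (n i + 2) ^ 2 + 1) * eR i)
      + 3 * (F.P Kt).d * (n i + 2) ^ 2 * eR i) ≤ ρn i)
    {γ cJ bx : ℝ} (hγ : 0 < γ) (hcJ : 0 ≤ cJ) (hbx : 0 ≤ bx)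
    (hbxM : ∀ i, 12 * ((F.P Kt).d : ℝ) * ((n i : ℝ) + 2) ^ 2 ≤ bx * (M i) ^ 2)
    {R 𝓐₀ : ι → ℝ} (hM : ∀ i, 1 ≤ (M i)) (hR : ∀ i, 0 < R i) (h𝓐₀ : ∀ i, 0 ≤ 𝓐₀ i)
    -- (J0′), R-EXPLICIT: per instance one radius and one bound for every base field of the strict guard
    (hMin : ∀ i Vk, PlaqSmallOn (plaqsInside (pts (k i) (Z i ∩ (Λ i)ᶜ))) (eR i) Vk →
      ∃ Ũ : VecField (F.P Kt) (k i) (EuclideanSpace ℂ (Fin 3)) × VecField (F.P Kt) (k i) (EuclideanSpace ℂ (Fin 3)) →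
          PBond (F.P Kt) 0 → Matrix (Fin 2) (Fin 2) ℂ,
        (∀ b a c, DifferentiableOn ℂ (fun z => Ũ z b a c) (ball 0 (R i))) ∧
        (∀ z ∈ ball (0 : VecField (F.P Kt) (k i) (EuclideanSpace ℂ (Fin 3)) × VecField (F.P Kt) (k i) (EuclideanSpace ℂ (Fin 3))) (R i),
          ∀ b a c, ‖Ũ z b a c‖ ≤ 𝓐₀ i) ∧
        ∀ p B' : VecField (F.P Kt) (k i) E3, ‖p‖ < R i → ‖B'‖ < R i → ∃ U' : GaugeField (F.P Kt) 0 SU2,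
          (∀ b, Ũ (cplxVec p, cplxVec B') b = ((U' b : SU2) : Matrix (Fin 2) (Fin 2) ℂ)) ∧
            IsMinimizer (Node00.avOfRecord F 2 Kt) (Node00.regMSCoPOfRecord F 2 ν Kt (k i) (maxDomT ν.M₁ (Z i))) (Bj ν.M₁ (Z i) (k i))
              (avgFamily (Node00.avOfRecord F 2 Kt) (qsstarGIter0 (k i) (expMul su2Chart B' (ext i (expMul su2Chart p Vk))))) U')
    -- dag-n12-w4's GEOMETRY letter of the chart file (the window box and its two shifts inside `Ω_k(Z)`)
    (hΩw : ∀ i, ∀ (ν' : Fin (F.P Kt).d), ∀ z ∈ box (fun κ => (hi i κ - lo i κ + 1).toNat + 3) (fun κ => lo i κ - 2),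
      (castSite z : Site (F.P Kt) (k i)) ∈ pts (k i) (maxDomT ν.M₁ (Z i) (k i)) ∧
        (castSite z : Site (F.P Kt) (k i)).shift ⟨0, h0⟩ ∈ pts (k i) (maxDomT ν.M₁ (Z i) (k i)) ∧
        (castSite z : Site (F.P Kt) (k i)).shift ν' ∈ pts (k i) (maxDomT ν.M₁ (Z i) (k i)))
    -- the WINDOW per instance, containing every plaquette whose source lies in the fine image of the enlarged window box (the chart half's `hW`)
    (W : ι → Finset (Plaq (F.P Kt) 0))
    (hWbox : ∀ i, ∀ q : Plaq (F.P Kt) 0, q.src ∈ ((box (fun κ => (F.P Kt).L ^ (k i) * ((hi i κ - lo i κ + 1).toNat + 3 + 1) - 1) (fun κ => ((F.P Kt).L : ℤ) ^ (k i) * (lo i κ - 2))).image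
        (fun z => (castSite z : Site (F.P Kt) 0))) → q ∈ W i)
    -- THE CHART HALF, DISPLAYED, `hsb`-FREE AND IN PER-ROW ℓ¹ CURRENCY (LOCATED-FLOOR + LOCATED-HSB + census U2b): FIVE per-height constants as BINDERS and ONE letter = the ∀-body of
    -- dag-n12-c g22's ρ6b `N12DirectChartPackageOfClassRowL1Family.exists_hWD_chartHalf_of_class_uniform_rowl1_family` at height `k i` (the right inverse `H` witnesses surjectivity only;
    -- its size enters through the PER-ROW ℓ¹ PREIMAGE LETTER at `B₁`, the curvature through the ℓ¹-curvature letter at `M₂`; (μ) constant `2(d−1)·εP·B₁·M₂` — NO torus bond count)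
    (C ρ Kτ ρτ ρ5 : ι → ℝ) (hρ : ∀ i, 0 < ρ i) (hKτ : ∀ i, 0 ≤ Kτ i) (hρτ : ∀ i, 0 < ρτ i)
    (hhalf : ∀ i,
        ∀ (ν : Node00.Stage7Numerics) (Z Λ : Set (Site (F.P Kt) 0)) (T : Finset (PBond (F.P Kt) (k i))) (lo hi : Fin (F.P Kt).d → ℤ),
        (∀ κ, ((((hi κ - lo κ + 1).toNat + 3 : ℕ) : ℤ)) ≤ (F.P Kt).sitesPerDir (k i)) →
        (∀ (ν' : Fin (F.P Kt).d), ∀ z ∈ box (fun κ => (hi κ - lo κ + 1).toNat + 3) (fun κ => lo κ - 2),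
          (castSite z : Site (F.P Kt) (k i)) ∈ pts (k i) (maxDomT ν.M₁ Z (k i)) ∧ (castSite z : Site (F.P Kt) (k i)).shift ⟨0, h0⟩ ∈ pts (k i) (maxDomT ν.M₁ Z (k i)) ∧
            (castSite z : Site (F.P Kt) (k i)).shift ν' ∈ pts (k i) (maxDomT ν.M₁ Z (k i))) →
        (k i) + 1 ≤ (F.P Kt).m + (F.P Kt).K → 4 * (F.P Kt).L ≤ ν.M₁ → side (F.P Kt).L ν.M₁ (k i) ∣ (F.P Kt).sitesPerDir 0 → 0 ≤ ν.εreg →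
        6 * ((((F.P Kt).d - 1 : ℕ)) : ℝ) * (F.P Kt).L * ν.εreg ≤ ρ5 i →
        ∀ (ext : GaugeField (F.P Kt) (k i) SU2 → GaugeField (F.P Kt) (k i) SU2) (Vk : GaugeField (F.P Kt) (k i) SU2),
        ∀ (U₀ : GaugeField (F.P Kt) 0 SU2) (Xf : GaugeSlice (pts (k i) Λ) T E3 → PBond (F.P Kt) 0 → lieSU (Fin 2)),
        IsMinimizer (Node00.avOfRecord F 2 Kt) (Node00.regMSCoPOfRecord F 2 ν Kt (k i) (maxDomT ν.M₁ Z)) (Bj ν.M₁ Z (k i))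
          (avgFamily (Node00.avOfRecord F 2 Kt) (qsstarGIter0 (k i) (ext Vk))) U₀ →
        ∀ ⦃εP : ℝ⦄, 0 ≤ εP →
        (∀ p : Plaq (F.P Kt) 0, ((⟨p.src, p.μ⟩ : PBond (F.P Kt) 0) ∈ {b : PBond (F.P Kt) 0 | b.src ∈ maxDomT ν.M₁ Z 1} ∨
            (⟨p.src.shift p.μ, p.ν⟩ : PBond (F.P Kt) 0) ∈ {b : PBond (F.P Kt) 0 | b.src ∈ maxDomT ν.M₁ Z 1} ∨
            (⟨p.src.shift p.ν, p.μ⟩ : PBond (F.P Kt) 0) ∈ {b : PBond (F.P Kt) 0 | b.src ∈ maxDomT ν.M₁ Z 1} ∨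
            (⟨p.src, p.ν⟩ : PBond (F.P Kt) 0) ∈ {b : PBond (F.P Kt) 0 | b.src ∈ maxDomT ν.M₁ Z 1}) →
          ‖((GaugeField.plaqHol U₀ p : SU2) : Matrix (Fin 2) (Fin 2) ℂ) - 1‖ ≤ εP) →
        ∀ (H : (Fin (constrCard (Bj ν.M₁ Z (k i)) (k i)) → lieSU (Fin 2)) → PBond (F.P Kt) 0 → lieSU (Fin 2)),
        (∀ v, fderiv ℝ (msChart F 2 Kt (k i) (Bj ν.M₁ Z (k i)) (avgFamily (avOfRecord F 2 Kt) (qsstarGIter0 (k i) (ext Vk))) U₀) 0 (H v) = v) →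
        ∀ ⦃B₁ : ℝ⦄, 0 ≤ B₁ →
        (∀ i' : Fin (constrCard (Bj ν.M₁ Z (k i)) (k i)), 1 ≤ ((((constrEnum (Bj ν.M₁ Z (k i)) (k i)).symm i').1 : ℕ)) → ∀ ξ : lieSU (Fin 2),
          ∃ x : PBond (F.P Kt) 0 → lieSU (Fin 2), fderiv ℝ (msChart F 2 Kt (k i) (Bj ν.M₁ Z (k i)) (avgFamily (avOfRecord F 2 Kt) (qsstarGIter0 (k i) (ext Vk))) U₀) 0 x = Pi.single i' ξ ∧
            ∑ b, ‖(x b : Matrix (Fin 2) (Fin 2) ℂ)‖ ≤ B₁ * ‖ξ‖) →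
        ∀ ⦃M₂ : ℝ⦄, (∀ w, ∑ c, ‖fderiv ℝ (fderiv ℝ (msChart F 2 Kt (k i) (Bj ν.M₁ Z (k i)) (avgFamily (avOfRecord F 2 Kt) (qsstarGIter0 (k i) (ext Vk))) U₀)) 0 w w c‖ ≤ M₂ * ∑ b, ‖w b‖ ^ 2) →
        Xf 0 = 0 → ContDiffAt ℝ 2 Xf 0 →
        (∀ᶠ Y in 𝓝 (0 : GaugeSlice (pts (k i) Λ) T E3),
          IsMinimizer (Node00.avOfRecord F 2 Kt) (Node00.regMSCoPOfRecord F 2 ν Kt (k i) (maxDomT ν.M₁ Z)) (Bj ν.M₁ Z (k i))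
            (avgFamily (Node00.avOfRecord F 2 Kt) (qsstarGIter0 (k i) (expMul su2Chart (ιA (pts (k i) Λ) T Y) (ext Vk)))) (expChart U₀ (Xf Y))) →
        ∀ ⦃K₂ : ℝ⦄, (∀ X : GaugeSlice (pts (k i) Λ) T E3, Real.sqrt (∑ b, ‖fderiv ℝ Xf 0 X b‖ ^ 2) ≤ K₂ * ‖X‖) →
        ∀ (W : Finset (Plaq (F.P Kt) 0)),
        (∀ q : Plaq (F.P Kt) 0, q.src ∈ ((box (fun κ => (F.P Kt).L ^ (k i) * ((hi κ - lo κ + 1).toNat + 3 + 1) - 1) (fun κ => ((F.P Kt).L : ℤ) ^ (k i) * (lo κ - 2))).image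
            (fun z => (castSite z : Site (F.P Kt) 0))) → q ∈ W) →
        ∀ ⦃δW : ℝ⦄, 0 < δW → δW < ρ i → δW < ρτ i →
        (∀ (ν' : Fin (F.P Kt).d), ∀ z ∈ box (fun κ => (hi κ - lo κ + 1).toNat + 3) (fun κ => lo κ - 2), ∀ b₀ : PBond (F.P Kt) 0,
          (b₀ ∈ feeds (k i) (⟨(castSite z : Site (F.P Kt) (k i)), ⟨0, h0⟩⟩ : PBond (F.P Kt) (k i)) ∨ b₀ ∈ feeds (k i) (⟨((castSite z : Site (F.P Kt) (k i))).shift ⟨0, h0⟩, ν'⟩ : PBond (F.P Kt) (k i))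
          ∨ b₀ ∈ feeds (k i) (⟨((castSite z : Site (F.P Kt) (k i))).shift ν', ⟨0, h0⟩⟩ : PBond (F.P Kt) (k i)) ∨ b₀ ∈ feeds (k i) (⟨(castSite z : Site (F.P Kt) (k i)), ν'⟩ : PBond (F.P Kt) (k i))) →
          ‖((U₀ b₀ : SU2) : Matrix (Fin 2) (Fin 2) ℂ) - 1‖ ≤ δW) →
        ∃ (Ψ₂ : (PBond (F.P Kt) 0 → lieSU (Fin 2)) →L[ℝ] (PBond (F.P Kt) 0 → lieSU (Fin 2)) →L[ℝ] (Fin (constrCard (Bj ν.M₁ Z (k i)) (k i)) → lieSU (Fin 2)))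
          (lam : (Fin (constrCard (Bj ν.M₁ Z (k i)) (k i)) → lieSU (Fin 2)) →L[ℝ] ℝ)
          (p : Seminorm ℝ (PBond (F.P Kt) 0 → lieSU (Fin 2))),
          HasFDerivAt (fun Y => fderiv ℝ (msChart F 2 Kt (k i) (Bj ν.M₁ Z (k i)) (avgFamily (avOfRecord F 2 Kt) (qsstarGIter0 (k i) (ext Vk))) U₀) Y) Ψ₂ 0 ∧
          (∀ᶠ Y in 𝓝 (0 : PBond (F.P Kt) 0 → lieSU (Fin 2)), DifferentiableAt ℝ (msChart F 2 Kt (k i) (Bj ν.M₁ Z (k i)) (avgFamily (avOfRecord F 2 Kt) (qsstarGIter0 (k i) (ext Vk))) U₀) Y) ∧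
          fderiv ℝ (fun Y : PBond (F.P Kt) 0 → lieSU (Fin 2) => wilsonAction4 (expChart U₀ Y)) 0 = lam.comp (fderiv ℝ (msChart F 2 Kt (k i) (Bj ν.M₁ Z (k i)) (avgFamily (avOfRecord F 2 Kt) (qsstarGIter0 (k i) (ext Vk))) U₀) 0) ∧
          (∀ Y : PBond (F.P Kt) 0 → lieSU (Fin 2), ∑ b, ‖(Y b : Matrix (Fin 2) (Fin 2) ℂ)‖ ^ 2 ≤ p Y ^ 2) ∧
          ∀ X : GaugeSlice (pts (k i) Λ) T E3,
            lam (Ψ₂ (fderiv ℝ Xf 0 X) (fderiv ℝ Xf 0 X))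
                ≤ (2 * (((F.P Kt).d : ℝ) - 1) * εP * B₁ * M₂) * p (fderiv ℝ Xf 0 X) ^ 2 ∧
            p (fderiv ℝ Xf 0 X) ≤ K₂ * ‖X‖ ∧
            (((F.P Kt).L : ℝ) ^ (F.P Kt).d) ^ (k i) / ((((F.P Kt).L : ℝ)) ^ 2 * ((F.P Kt).L : ℝ) ^ 2) ^ (k i) / 2 * (∑ z ∈ box (fun κ => (hi κ - lo κ + 1).toNat + 3) (fun κ => lo κ - 2), ∑ μ : Fin (F.P Kt).d, ∑ a : Fin 3, curl (fun b => ιA (pts (k i) Λ) T X (⟨castSite b.1, b.2⟩ : PBond (F.P Kt) (k i)) a) z ⟨0, h0⟩ μ ^ 2)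
                - (((F.P Kt).L : ℝ) ^ (F.P Kt).d) ^ (k i) / ((((F.P Kt).L : ℝ)) ^ 2 * ((F.P Kt).L : ℝ) ^ 2) ^ (k i) * (8 * (((F.P Kt).d : ℝ) + 1) * (2 * ((Kτ i) + 1) * δW) + 8 * ((F.P Kt).d : ℝ) * (((box (fun κ => (hi κ - lo κ + 1).toNat + 3) (fun κ => lo κ - 2)).image (fun z => (castSite z : Site (F.P Kt) (k i)))).card : ℝ) * ((C i) * δW * K₂) ^ 2) * ‖X‖ ^ 2
              ≤ ((Fintype.card (Fin 2) : ℝ)⁻¹ • ∑ p ∈ W, (innerSL ℝ (E := lieSU (Fin 2))).bilinearComp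
                (ContinuousLinearMap.proj (R := ℝ) (φ := fun _ : PBond (F.P Kt) 0 => lieSU (Fin 2)) (⟨p.src, p.μ⟩ : PBond (F.P Kt) 0) + ContinuousLinearMap.proj (R := ℝ) (φ := fun _ : PBond (F.P Kt) 0 => lieSU (Fin 2)) (⟨p.src.shift p.μ, p.ν⟩ : PBond (F.P Kt) 0)
                  - ContinuousLinearMap.proj (R := ℝ) (φ := fun _ : PBond (F.P Kt) 0 => lieSU (Fin 2)) (⟨p.src.shift p.ν, p.μ⟩ : PBond (F.P Kt) 0) - ContinuousLinearMap.proj (R := ℝ) (φ := fun _ : PBond (F.P Kt) 0 => lieSU (Fin 2)) (⟨p.src, p.ν⟩ : PBond (F.P Kt) 0) : (PBond (F.P Kt) 0 → lieSU (Fin 2)) →L[ℝ] lieSU (Fin 2))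
                (ContinuousLinearMap.proj (R := ℝ) (φ := fun _ : PBond (F.P Kt) 0 => lieSU (Fin 2)) (⟨p.src, p.μ⟩ : PBond (F.P Kt) 0) + ContinuousLinearMap.proj (R := ℝ) (φ := fun _ : PBond (F.P Kt) 0 => lieSU (Fin 2)) (⟨p.src.shift p.μ, p.ν⟩ : PBond (F.P Kt) 0)
                  - ContinuousLinearMap.proj (R := ℝ) (φ := fun _ : PBond (F.P Kt) 0 => lieSU (Fin 2)) (⟨p.src.shift p.ν, p.μ⟩ : PBond (F.P Kt) 0) - ContinuousLinearMap.proj (R := ℝ) (φ := fun _ : PBond (F.P Kt) 0 => lieSU (Fin 2)) (⟨p.src, p.ν⟩ : PBond (F.P Kt) 0) : (PBond (F.P Kt) 0 → lieSU (Fin 2)) →L[ℝ] lieSU (Fin 2))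
                : (PBond (F.P Kt) 0 → lieSU (Fin 2)) →L[ℝ] (PBond (F.P Kt) 0 → lieSU (Fin 2)) →L[ℝ] ℝ) (fderiv ℝ Xf 0 X) (fderiv ℝ Xf 0 X))
    -- the `hsb`-free letter's numeric premises displayed: radius row, the class threshold positive, and its floor against the per-height curvature radius `ρ5`
    (hM4 : 4 * (F.P Kt).L ≤ ν.M₁) (hεreg : 0 < ν.εreg) (hερ : ∀ i, 6 * ((((F.P Kt).d - 1 : ℕ)) : ℝ) * (F.P Kt).L * ν.εreg ≤ ρ5 i)
    -- THE (P4)′ PRODUCER's TWO CONSTANTS, THE (P5) CONSTANT AND THE NEAR-FLAT GUARD RADIUS PER INSTANCE, AS BINDERS (`εH`, `ρ6`, `M₂` per height; `B₁` per `(M₁, Z)` — never after `εreg`∕`ρn`),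
    -- and THREE LETTERS displayed: `hHrow` = dag-n12-w6 g7's `N12DirectSurjHsurjProxies.exists_rightInverse_letter_of_proxies` (p678596) premises at `(2, Kt, k i, ν.M₁, Z i; εH i)` VERBATIM —
    -- NO `SmallBelow U₀`: its guarded PROXIES (per constrained bond, per inner site) are produced from the class below — concluding, in ρ6b's PER-ROW ℓ¹ CURRENCY, a right inverse `H`
    -- (surjectivity witness) AND the per-row ℓ¹ preimage letter at `B₁ i`; `hsbU` ∕ `hcurv` = the two conjuncts of dag-n12-w4's `Node00.exists_uniform_chartCurvature_sq_bound (k i)` at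
    -- `(ρ6 i, M₂ i)` (near-flat fields are guarded; uniform sup-curvature bound at the near-flat core) — ρ7 turns them into the ℓ¹-curvature bound with the local count `Σ_{j≤k i}(2d)^j`
    (εH B₁ M₂ ρ6 : ι → ℝ) (hB1 : ∀ i, 0 ≤ B₁ i) (hM₂0 : ∀ i, 0 ≤ M₂ i)
    (hHrow : ∀ i (Wd : MSField (F.P Kt) SU2) (U₀ : GaugeField (F.P Kt) 0 SU2),
      AgreeOn (Bj ν.M₁ (Z i) (k i)) (avgFamily (Node00.avOfRecord F 2 Kt) U₀) Wd →
      (∀ i' : Fin (constrCard (Bj ν.M₁ (Z i) (k i)) (k i)), ∃ U' : GaugeField (F.P Kt) 0 SU2,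
        (∀ b ∈ feeds (((constrEnum (Bj ν.M₁ (Z i) (k i)) (k i)).symm i').1 : ℕ) ((constrEnum (Bj ν.M₁ (Z i) (k i)) (k i)).symm i').2.1, U' b = U₀ b) ∧
          Node00.SmallBelow (Node00.avOfRecord F 2 Kt) (k i) U') →
      (∀ (j : ℕ), 1 ≤ j → j ≤ k i → ∀ y : Site (F.P Kt) j, embIter j y ∈ maxDomT ν.M₁ (Z i) j → ∃ U' : GaugeField (F.P Kt) 0 SU2,
        (∀ c : PBond (F.P Kt) j, (c.src = y ∨ c.tgt = y) → ∀ b₀ : PBond (F.P Kt) 0,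
          (iterBlockOf j b₀.src = c.src ∨ iterBlockOf j b₀.src = c.tgt) → (iterBlockOf j b₀.tgt = c.src ∨ iterBlockOf j b₀.tgt = c.tgt) → U' b₀ = U₀ b₀) ∧
        Node00.SmallBelow (Node00.avOfRecord F 2 Kt) (k i) U') →
      (∀ (j : ℕ), 1 ≤ j → j ≤ k i → ∀ y : Site (F.P Kt) j, embIter j y ∈ maxDomT ν.M₁ (Z i) j →
        PlaqSmallOn (boxPlaqs (fun κ => lift (F.P Kt) (embIter j y) κ - ((((F.P Kt).L ^ j : ℕ) : ℤ) + ((((F.P Kt).L ^ j - 1) / 2 : ℕ) : ℤ)))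
          (fun κ => lift (F.P Kt) (embIter j y) κ + ((((F.P Kt).L ^ j : ℕ) : ℤ) + ((((F.P Kt).L ^ j - 1) / 2 : ℕ) : ℤ))) : Set (Plaq (F.P Kt) 0)) (εH i) U₀) →
      ∃ H : (Fin (constrCard (Bj ν.M₁ (Z i) (k i)) (k i)) → lieSU (Fin 2)) → PBond (F.P Kt) 0 → lieSU (Fin 2),
        (∀ v, fderiv ℝ (msChart F 2 Kt (k i) (Bj ν.M₁ (Z i) (k i)) Wd U₀) 0 (H v) = v) ∧
        ∀ i' : Fin (constrCard (Bj ν.M₁ (Z i) (k i)) (k i)), 1 ≤ ((((constrEnum (Bj ν.M₁ (Z i) (k i)) (k i)).symm i').1 : ℕ)) → ∀ ξ : lieSU (Fin 2),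
          ∃ x : PBond (F.P Kt) 0 → lieSU (Fin 2), fderiv ℝ (msChart F 2 Kt (k i) (Bj ν.M₁ (Z i) (k i)) Wd U₀) 0 x = Pi.single i' ξ ∧
            ∑ b, ‖(x b : Matrix (Fin 2) (Fin 2) ℂ)‖ ≤ B₁ i * ‖ξ‖)
    (hsbU : ∀ i (V : GaugeField (F.P Kt) 0 SU2), ‖coeField V - 1‖ ≤ ρ6 i → Node00.SmallBelow (Node00.avOfRecord F 2 Kt) (k i) V)
    (hcurv : ∀ i (𝔹 : DetSet (F.P Kt)) (Wd : MSField (F.P Kt) SU2) (V : GaugeField (F.P Kt) 0 SU2),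
      ‖coeField V - 1‖ ≤ ρ6 i → AgreeOn 𝔹 (avgFamily (Node00.avOfRecord F 2 Kt) V) Wd →
      ∀ w : PBond (F.P Kt) 0 → lieSU (Fin 2), ‖fderiv ℝ (fderiv ℝ (msChart F 2 Kt (k i) 𝔹 Wd V)) 0 w w‖ ≤ M₂ i * ‖w‖ ^ 2)
    -- the near-flat radius's floor on the class threshold (volume-free)
    (hερ6 : ∀ i, 6 * ((((F.P Kt).d - 1 : ℕ)) : ℝ) * (F.P Kt).L * ν.εreg ≤ ρ6 i)
    -- NO letter per guarded base field ∕ minimiser remains here: the (P4)′ socket and the (P5) row are DISCHARGED below from the class through `hHrow` ∕ `hsbU` ∕ `hcurv` (+ ρ7's local count)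
    -- numerics: the positivity constant fits (`γ₀ := 1∕2`: the chart half's level factor `((L^d)^k∕(L²·L²)^k)∕2` at `d = 4`)
    (hγle : ∀ i, γ / (M i) ^ 5 ≤ 1 / 2 / (2 * (3 * (K i : ℝ) ^ 2 + 2 * (K i : ℝ) ^ 4)))
    (hfar : ∀ i (b : PBond (F.P Kt) 0), b.src ∉ maxDomT ν.M₁ (Z i) 1 →
      (⟨blockIter (k i) b.src, b.dir⟩ : PBond (F.P Kt) (k i)) ∉ bondsOf (pts (k i) (Λ i)))
    (hZblk : ∀ i, IsBlockUnion (k i) (Z i))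
    (hM2 : 2 ≤ ν.M₁) (hdiv : ∀ i, side (F.P Kt).L ν.M₁ (k i) ∣ (F.P Kt).sitesPerDir 0)
    {cE B₃ a₀ a₁' cA : ℝ} (hcE0 : 0 ≤ cE) (hcE : ∀ i, 12 * ((F.P Kt).d : ℝ) * ((n i : ℝ) + 2) ^ 2 ≤ cE) (hB₃ : 0 ≤ B₃)
    (heRa : ∀ i, (cE + 1) * eR i ≤ a₁' ∧ B₃ * ((cE + 1) * eR i) ≤ ν.εreg) (ha₀ : ν.εreg ≤ a₀)
    (hcA : ∀ i, 1 / 2 * (B₃ * (cE + 1) * (F.P Kt).eta 1 ^ 2) ^ 2 * (Nat.card {q : Plaq (F.P Kt) 0 // q ∈ plaqsOf (maxDomT ν.M₁ (Z i) 1)} : ℝ) ≤ cA)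
    (h15T : ∀ (k' : ℕ), k' ≤ (F.P Kt).m + (F.P Kt).K → side (F.P Kt).L ν.M₁ k' ∣ (F.P Kt).sitesPerDir 0 →
      ∀ (s : B14.Eq218Concrete.Seq (fun n : ℕ => Node00.unionsOfCubes (F.P Kt) (side (F.P Kt).L ν.M₁ n)) k'),
      Node00.Sect2.SeqSeparated ν.M₁ s → 0 < ν.M₁ →
      ∀ (ε₀ : ℝ) (δ : ℕ → ℝ), (∀ j, j ≤ k' → 0 < δ j ∧ δ j ≤ a₁' ∧ B₃ * δ j ≤ ε₀) → (∀ j, j < k' → δ j ≤ 2 * δ (j + 1)) →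
      (∀ j, j < k' → δ (j + 1) ≤ 2 * δ j) → ε₀ ≤ a₀ →
      ∀ W : MSField (F.P Kt) SU2,
        Node00.Sect2.DataSmall7PTop (Node00.avOfRecord F 2 Kt) s.Ω (Node00.suppDomOfRecord F ν Kt s.Ω) k' δ W →
        ∀ U₀ : GaugeField (F.P Kt) 0 SU2, IsMinimizer (Node00.avOfRecord F 2 Kt)
            {U | (∀ j, j ≤ k' → PlaqSmallOn (Node00.Sect2.omegaPlaqsTop s.Ω (Node00.suppDomOfRecord F ν Kt s.Ω) j)
                (ε₀ * (F.P Kt).eta j ^ 2) U) ∧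
              Node00.Sect2.CoDivClassOnTop s.Ω (Node00.suppDomOfRecord F ν Kt s.Ω) k' ε₀ U}
            (genSet s.Ω k') W U₀ →
          (∀ j, j ≤ k' → PlaqSmallOn (Node00.Sect2.omegaPlaqsTop s.Ω (Node00.suppDomOfRecord F ν Kt s.Ω) j)
              (B₃ * δ j * (F.P Kt).eta j ^ 2) U₀) ∧
            ∀ j, j ≤ k' → Node00.Sect2.CoDivSmallOn (Node00.Sect2.omegaBondsTop s.Ω (Node00.suppDomOfRecord F ν Kt s.Ω) j)
              (B₃ * δ j * (F.P Kt).eta j ^ 3) U₀)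
    (hcJ' : ∀ i, 2 * cA * eR i / R i + 2 * ((Nat.card {q : Plaq (F.P Kt) 0 // q ∈ plaqsOf (maxDomT ν.M₁ (Z i) 1)} : ℝ) * (1 + 8 * 𝓐₀ i ^ 4)) / (R i * eR i) ≤ cJ)
    -- THE EXPLICIT-THRESHOLD FRAME (no `∃ δ₀`): tolerances below `min (Θ i) (εH i)`, `Θ i := min (min (ρ i) (ρτ i) ∕ 2) (min 1 (rhs_i ∕ (max S_i 0 + 1)))`, every symbol a binder, a
    -- LARGE-FIELD-REGION count or the closed-form local count `Σ_{j ≤ k i} (2d)^j` — NO torus bond count in the (μ)-term (census U2b)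
    : ∀ δ : ι → ℝ, (∀ i, 0 < δ i) →
      (∀ i, δ i ≤ min (min (min (ρ i) (ρτ i) / 2)
        (min 1 (1 / 2 / (2 * (3 * (K i : ℝ) ^ 2 + 2 * (K i : ℝ) ^ 4)) /
          (max ((32 * (((F.P Kt).d : ℝ) - 1) + 8 * (((F.P Kt).d : ℝ) - 1) + (2 * (((F.P Kt).d : ℝ) - 1) * B₁ i * (((∑ j ∈ Finset.range (k i + 1), (2 * (F.P Kt).d) ^ j : ℕ) : ℝ) * M₂ i))) * (12 * 𝓐₀ i / R i * Real.sqrt (Nat.card {b : PBond (F.P Kt) 0 // b.src ∈ maxDomT ν.M₁ (Z i) 1})) ^ 2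
            + (8 * (((F.P Kt).d : ℝ) + 1) * (2 * (Kτ i + 1)) + 8 * ((F.P Kt).d : ℝ) * (((box (fun κ => (hi i κ - lo i κ + 1).toNat + 3) (fun κ => lo i κ - 2)).image (fun z => (castSite z : Site (F.P Kt) (k i)))).card : ℝ) * (C i * (12 * 𝓐₀ i / R i * Real.sqrt (Nat.card {b : PBond (F.P Kt) 0 // b.src ∈ maxDomT ν.M₁ (Z i) 1}))) ^ 2)) 0 + 1)))) (εH i)) →
      -- (σ)_W THE WINDOW GAUGE LETTER at tolerance `δ i` on the window's plaquette bonds and on the feeds (dag-n12-c's §2 text at `δc = δW := δ i`)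
      ∀ (hσW : ∀ i (Vk : GaugeField (F.P Kt) (k i) SU2), PlaqSmallOn (plaqsInside (pts (k i) (Z i ∩ (Λ i)ᶜ))) (eR i) Vk →
      (∀ b ∈ (boxBonds (LO i) (HI i) : Set (PBond (F.P Kt) (k i))), dist1 (ext i Vk b) ≤ ρn i) →
      ∀ U₀ : GaugeField (F.P Kt) 0 SU2,
        IsMinimizer (Node00.avOfRecord F 2 Kt) (Node00.regMSCoPOfRecord F 2 ν Kt (k i) (maxDomT ν.M₁ (Z i))) (Bj ν.M₁ (Z i) (k i))
          (avgFamily (Node00.avOfRecord F 2 Kt) (qsstarGIter0 (k i) (ext i Vk))) U₀ →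
        ∃ σ : GaugeTransf (F.P Kt) 0 SU2,
          (∀ j, j ≤ k i → ∀ b ∈ bondsOf (Bj ν.M₁ (Z i) (k i) j), toMS σ j b.src = 1 ∧ toMS σ j b.tgt = 1) ∧
          (∀ p ∈ W i, ‖((gaugeAct σ U₀ ⟨p.src, p.μ⟩ : SU2) : Matrix (Fin 2) (Fin 2) ℂ) - 1‖ ≤ δ i ∧ ‖((gaugeAct σ U₀ ⟨p.src.shift p.μ, p.ν⟩ : SU2) : Matrix (Fin 2) (Fin 2) ℂ) - 1‖ ≤ δ i ∧
            ‖((gaugeAct σ U₀ ⟨p.src.shift p.ν, p.μ⟩ : SU2) : Matrix (Fin 2) (Fin 2) ℂ) - 1‖ ≤ δ i ∧ ‖((gaugeAct σ U₀ ⟨p.src, p.ν⟩ : SU2) : Matrix (Fin 2) (Fin 2) ℂ) - 1‖ ≤ δ i) ∧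
          (∀ (ν' : Fin (F.P Kt).d), ∀ z ∈ box (fun κ => (hi i κ - lo i κ + 1).toNat + 3) (fun κ => lo i κ - 2), ∀ b₀ : PBond (F.P Kt) 0,
            (b₀ ∈ feeds (k i) (⟨(castSite z : Site (F.P Kt) (k i)), ⟨0, h0⟩⟩ : PBond (F.P Kt) (k i)) ∨
              b₀ ∈ feeds (k i) (⟨((castSite z : Site (F.P Kt) (k i))).shift ⟨0, h0⟩, ν'⟩ : PBond (F.P Kt) (k i)) ∨
              b₀ ∈ feeds (k i) (⟨((castSite z : Site (F.P Kt) (k i))).shift ν', ⟨0, h0⟩⟩ : PBond (F.P Kt) (k i)) ∨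
              b₀ ∈ feeds (k i) (⟨(castSite z : Site (F.P Kt) (k i)), ν'⟩ : PBond (F.P Kt) (k i))) →
            ‖((gaugeAct σ U₀ b₀ : SU2) : Matrix (Fin 2) (Fin 2) ℂ) - 1‖ ≤ δ i))
      -- THE PLAQUETTE LETTER at tolerance `δ i`: every (2.12) minimiser of the guarded datum is `δ i`-plaquette-small on the plaquettes with a bond starting in `Ω₁(Z_i)` (P1 and the
      -- chart half's (μ)-row input; the class ∕ [15] Thm 1 (8) reading)
      (hPχ : ∀ i (Vk : GaugeField (F.P Kt) (k i) SU2), PlaqSmallOn (plaqsInside (pts (k i) (Z i ∩ (Λ i)ᶜ))) (eR i) Vk →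
      (∀ b ∈ (boxBonds (LO i) (HI i) : Set (PBond (F.P Kt) (k i))), dist1 (ext i Vk b) ≤ ρn i) →
      ∀ U₀ : GaugeField (F.P Kt) 0 SU2,
        IsMinimizer (Node00.avOfRecord F 2 Kt) (Node00.regMSCoPOfRecord F 2 ν Kt (k i) (maxDomT ν.M₁ (Z i))) (Bj ν.M₁ (Z i) (k i))
          (avgFamily (Node00.avOfRecord F 2 Kt) (qsstarGIter0 (k i) (ext i Vk))) U₀ →
        ∀ p : Plaq (F.P Kt) 0, ((⟨p.src, p.μ⟩ : PBond (F.P Kt) 0) ∈ {b : PBond (F.P Kt) 0 | b.src ∈ maxDomT ν.M₁ (Z i) 1} ∨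
            (⟨p.src.shift p.μ, p.ν⟩ : PBond (F.P Kt) 0) ∈ {b : PBond (F.P Kt) 0 | b.src ∈ maxDomT ν.M₁ (Z i) 1} ∨
            (⟨p.src.shift p.ν, p.μ⟩ : PBond (F.P Kt) 0) ∈ {b : PBond (F.P Kt) 0 | b.src ∈ maxDomT ν.M₁ (Z i) 1} ∨
            (⟨p.src, p.ν⟩ : PBond (F.P Kt) 0) ∈ {b : PBond (F.P Kt) 0 | b.src ∈ maxDomT ν.M₁ (Z i) 1}) →
          ‖((GaugeField.plaqHol U₀ p : SU2) : Matrix (Fin 2) (Fin 2) ℂ) - 1‖ ≤ δ i)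
      -- THE TOWER-BOX PLAQUETTE LETTER at tolerance `δ i` (the plaquette premise of dag-n12-w6's (P4)′ producer `exists_rightInverse_letter`, verbatim at `(2, Kt, k i, ν.M₁, Z i)`):
      -- every (2.12) minimiser of the guarded datum is `δ i`-plaquette-small on the fine box of half-width `L^j + (L^j − 1)∕2` around `ι_j y` for every inner `j`-site `y` (`1 ≤ j ≤ k i`)
      (hPbox : ∀ i (Vk : GaugeField (F.P Kt) (k i) SU2), PlaqSmallOn (plaqsInside (pts (k i) (Z i ∩ (Λ i)ᶜ))) (eR i) Vk →
      (∀ b ∈ (boxBonds (LO i) (HI i) : Set (PBond (F.P Kt) (k i))), dist1 (ext i Vk b) ≤ ρn i) →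
      ∀ U₀ : GaugeField (F.P Kt) 0 SU2,
        IsMinimizer (Node00.avOfRecord F 2 Kt) (Node00.regMSCoPOfRecord F 2 ν Kt (k i) (maxDomT ν.M₁ (Z i))) (Bj ν.M₁ (Z i) (k i))
          (avgFamily (Node00.avOfRecord F 2 Kt) (qsstarGIter0 (k i) (ext i Vk))) U₀ →
        ∀ (j : ℕ), 1 ≤ j → j ≤ k i → ∀ y : Site (F.P Kt) j, embIter j y ∈ maxDomT ν.M₁ (Z i) j →
          PlaqSmallOn (boxPlaqs (fun κ => lift (F.P Kt) (embIter j y) κ - ((((F.P Kt).L ^ j : ℕ) : ℤ) + ((((F.P Kt).L ^ j - 1) / 2 : ℕ) : ℤ)))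
            (fun κ => lift (F.P Kt) (embIter j y) κ + ((((F.P Kt).L ^ j : ℕ) : ℤ) + ((((F.P Kt).L ^ j - 1) / 2 : ℕ) : ℤ))) : Set (Plaq (F.P Kt) 0)) (δ i) U₀),
      ∃ a₁ : ι → ℝ, (∀ i, 0 < a₁ i) ∧
      B15.Prop1Printed (lfVarOn su2Chart fun i =>
        InstOn.std (Node00.bgMSCoPOfRecord F 2 ν Kt (k i) (maxDomT ν.M₁ (Z i))) ν.M₁ (Z i) (Λ i) (k i) (M i) (a₁ i)
          (anExt (pts (k i) (Λ i)) (T i)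
            (fun177std (Node00.bgMSCoPOfRecord F 2 ν Kt (k i) (maxDomT ν.M₁ (Z i))) ν.M₁ (Z i) (k i)) (ext i)
            (min (1 / 2) (min (R i / 8) (γ / (M i) ^ 5 * (R i / 2) ^ 2 /
              (48 * (4 * ((Fintype.card (Plaq (F.P Kt) 0) : ℝ) * (1 + 8 * 𝓐₀ i ^ 4)) / R i + 1))))))) := by
  intro δ hδpos hδle hσW hPχ hPbox
  -- (P2c)‴ with (P4)′ fed by the proxies edition in per-row currency at `δ i ≤ εH i` (proxies from the class) and (P5) by ρ7's ℓ¹-curvature bound with the local count `Σ_{j≤k}(2d)^j`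
  exact exists_domain_prop1Printed_lfVarOn_std_su2_box_intrinsic_analytic_atZSeqCoPRecord_ofThm1TorusClass_ofMinimiserFamily_ofWindowGaugeLetter_ofChartHalfOfClassRowL1Near_explicit
    ν Kt hd3 h0 Z Λ k M hk0 hk1 eR heR T lo hi n hn hN hbox hZ hTG0 hN5 K hK1 hKn ext hext hlohi LO HI hLO hHI n' hn' hn'N hR' ρn hρn hγ hcJ hbx hbxM hM hR h𝓐₀
    hMin hΩw W hWbox C ρ Kτ ρτ ρ5 hρ hKτ hρτ hhalf hM4 hεreg hερ
    B₁ (fun i => (((∑ j ∈ Finset.range (k i + 1), (2 * (F.P Kt).d) ^ j : ℕ) : ℝ) * M₂ i)) hB1 (fun i => mul_nonneg (Nat.cast_nonneg _) (hM₂0 i))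
    (fun i Vk hg hdat U₀ hmin => hHrow i _ U₀ hmin.2.1
      (towerProxies_Bj_of_mem_class ν Kt (Z i) (hk1 i) hM4 (hdiv i) hεreg.le (hsbU i) (hερ6 i) hmin.1)
      (siteProxies_Bj_of_mem_class ν Kt (Z i) (hk1 i) hM4 (hdiv i) hεreg.le (hsbU i) (hερ6 i) hmin.1)
      fun j hj1 hjk y hy => plaqSmallOn_of_le ((hδle i).trans (min_le_right _ _)) (hPbox i Vk hg hdat U₀ hmin j hj1 hjk y hy))
    (fun i Vk _ _ U₀ hmin w => sum_norm_fderiv_fderiv_msChart_apply_le_of_class ν Kt (Z i) (hk1 i) hM4 (hdiv i) hεreg.le (hM₂0 i) (hsbU i) (hcurv i) (hερ6 i)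
      (fun b s hs => hovl_geometric _ _ b s hs) hmin w)
    hγle hfar hZblk hM2 hdiv hcE0 hcE hB₃ heRa ha₀ hcA h15T hcJ'
    δ hδpos (fun i => (hδle i).trans (min_le_left _ _)) hσW hPχ

end Summit.QuantumFields.YangMills.BalabanUVNodes.N12Prop1DirectOfClassOnlyRowL1Near

end
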